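import Mathlib
import Summits.ValiantsHypothesis.ValiantsHypothesis.Theorems.LacunarySymmetroidMatrixDescartesGramDualSigned
import Summits.ValiantsHypothesis.ValiantsHypothesis.Theorems.LacunarySymmetroidMatrixDescartesGramDualInertia
import Summits.ValiantsHypothesis.ValiantsHypothesis.Theorems.LacunarySymmetroidMatrixDescartesGramDualPencil

/-!
# `MatrixDescartes` (stmt-ValiantsHypothesis-18050) — Gram duality, part 16: THE SIGN-COHERENT GRAM LAW — a word
# whose Gram matrix is positive semidefinite on the positive columns and negative semidefinite on the negative
# columns has NO positive zero, whatever the exponents, the size, and the coupling between the two groups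

HONEST FRAMING.  Cell `pub-symmetroid`, seat `val-sym-mdr-p2` (gen 20); helper file `--supports` the crux
`Theses.LacunarySymmetroid.MatrixDescartes` (OPEN), NO closure claim; companion of `…GramDualSigned` (every lacunary
pencil with a non-degenerate base letter `B` at exponent `e` is a signed column word `X^e B + U diag(σⱼX^{δⱼ}) Uᵀ` and
has the positive zeros of its dual `diag(σⱼ⁻¹X^{E−δⱼ}) + X^{E−e}·UᵀB⁻¹U`).  A SECTOR LAW (a sterile configuration);
nothing here bears on the crux in its window, `stub_twoSided`, `DoorA26` / `DoorA34`, registers, or `VP ≠ VNP`.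

THE LAW (`posRoots_base_eq_empty_of_coherent`).  `B` real symmetric with `det B ≠ 0`, columns `uⱼ` (`U : ι × ρ`),
signs `σⱼ ≠ 0`, exponents `e, δⱼ` ARBITRARY (both sides of `e`, ties allowed), Gram matrix `C = UᵀB⁻¹U`.  Split the
columns by sign, `P = {j : σⱼ > 0}`, `N = {j : σⱼ < 0}`.  IF

  `C_PP ⪰ 0`  (the positive columns span a `B⁻¹`-NONNEGATIVE configuration: `vᵀCv ≥ 0` for `v` supported on `P`) and
  `C_NN ⪯ 0`  (the negative columns span a `B⁻¹`-NONPOSITIVE configuration),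

with NO condition on the cross block `C_PN` and no orthogonality anywhere, THEN `det(X^eB + U diag(σX^δ)Uᵀ)` has NO
positive zero.  Proof: at every `x > 0` the dual matrix `diag(σⱼ⁻¹x^{E−δⱼ}) + x^{E−e}C` is QUASI-DEFINITE for the sign
vector `sgn σ` — with `v' = (v_P, −v_N)` one has `v'ᵀ(diag + x^{E−e}C)v = Σⱼ|σⱼ|⁻¹x^{E−δⱼ}vⱼ² + x^{E−e}(v_PᵀCv_P − v_NᵀCv_N) > 0`
for `v ≠ 0` (the cross terms cancel by symmetry of `C`) — hence non-degenerate (`det_diagonal_add_ne_zero_of_coherent`),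
and primal and dual have the same positive zeros (`GramDual.posRoots_base_eq`).
SPECIAL CASES.  `posRoots_base_eq_empty_of_posSemidef_gram`: all `σⱼ > 0` (PSD letters) and `C ⪰ 0` ⇒ no positive zero
— PSD letters whose joint range is a `B⁻¹`-nonnegative subspace of an INDEFINITE base are sterile at every exponent
configuration (for `B ≻ 0` this is the trivial positive cone; the content is for indefinite `B`);
`posRoots_base_eq_empty_of_negSemidef_gram`: the mirror.  The FRAME LAW of `…GramDualSignedFrame`
(`Z₊ ≤ #{j : σⱼ·uⱼᵀB⁻¹uⱼ < 0}` for pairwise `B⁻¹`-orthogonal columns) has the zero case «no column disagrees in sign with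
its `B⁻¹`-norm»; the present law is that zero case WITHOUT a frame: coherence of the two Gram BLOCKS replaces
orthogonality, e.g. (`m = 2`, `B = diag(1,−1)`) any number of positive columns on one spacelike line and negative
columns on one timelike line, `det = −X^{2e} − 3X^e(A+B') − 9AB'` for the columns `(2,1)`, `(1,2)`.  In the crux's
currency (`coherent_pencil_posRoots_eq_empty`): a pencil `Σ_l X^{d_l}S_l` with `det S_{l₀} ≠ 0` whose other letters
are each PSD or NSD, with `S_{l₀}⁻¹ ⪰ 0` on the joint range of the PSD ones and `⪯ 0` on the joint range of the NSD
ones, has no positive zero of its determinant.  («Dead-end sterilisation» by SIGN STRUCTURE of the Gram matrix, not by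
parameter count; the quantitative question «`k` incoherent columns ⇒ Z₊ ≤ f(k)`?» is located, not claimed.)

[folklore] (quasi-definite matrices are non-singular; Sylvester duality of `…GramDualSigned`).  Axioms `propext`,
`Classical.choice`, `Quot.sound`.
-/

-- layout Summits/ValiantsHypothesis/ValiantsHypothesis forces the duplicated namespace component
set_option linter.dupNamespace false

namespace Summit.ValiantsHypothesis.ValiantsHypothesis.Theorems.LacunarySymmetroidMatrixDescartes

open Polynomial Matrix Finset
open scoped BigOperators

namespace GramDual

variable {ι ρ : Type*} [Fintype ι] [DecidableEq ι] [Fintype ρ] [DecidableEq ρ]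

/-- the signed column part `U · diag(σⱼ X^{δⱼ}) · Uᵀ` (file-local notation, as in `…GramDualSigned`) -/
local notation3 (prettyPrint := false) "𝕊[" U ", " σ ", " δ "]" =>
  ((U : Matrix _ _ ℝ).map Polynomial.C
      * Matrix.diagonal (fun j => Polynomial.C ((σ : _ → ℝ) j) * (Polynomial.X : Polynomial ℝ) ^ (δ j : ℕ))
      * ((U : Matrix _ _ ℝ).map Polynomial.C)ᵀ)

/-- the signed primal word `X^e • B + U · diag(σⱼ X^{δⱼ}) · Uᵀ` (file-local notation, as in `…GramDualSigned`) -/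
local notation3 (prettyPrint := false) "𝔽ₛ[" e ", " B ", " U ", " σ ", " δ "]" =>
  (((Polynomial.X : Polynomial ℝ) ^ (e : ℕ)) • (B : Matrix _ _ ℝ).map Polynomial.C + 𝕊[U, σ, δ])

/-! ## §1  Quasi-definite (sign-coherent) symmetric matrices are non-degenerate -/

omit [Fintype ι] [DecidableEq ι] [DecidableEq ρ] in
/-- For symmetric `C`: `v ⬝ᵥ C w = w ⬝ᵥ C v`. [folklore] -/
theorem dotProduct_mulVec_comm_of_isSymm {C : Matrix ρ ρ ℝ} (hC : C.IsSymm) (v w : ρ → ℝ) :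
    v ⬝ᵥ (C *ᵥ w) = w ⬝ᵥ (C *ᵥ v) := by
  rw [Matrix.dotProduct_mulVec, ← Matrix.mulVec_transpose, hC.eq, dotProduct_comm]

omit [Fintype ι] [DecidableEq ι] in
/-- **Quasi-definite matrices are non-degenerate.**  `C` real symmetric, `σⱼ` signs, `aⱼ` reals of the sign of `σⱼ`
(`σⱼ·aⱼ > 0`); if `vᵀCv ≥ 0` for every `v` supported on `{σ > 0}` and `vᵀCv ≤ 0` for every `v` supported on `{σ < 0}`,
then `det(diag(a) + C) ≠ 0`.  (With `v' = (v_P, −v_N)`: `v'ᵀ(diag(a) + C)v = Σ|aⱼ|vⱼ² + v_PᵀCv_P − v_NᵀCv_N`.) [folklore] -/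
theorem det_diagonal_add_ne_zero_of_coherent (a σ : ρ → ℝ) (C : Matrix ρ ρ ℝ) (hC : C.IsSymm)
    (ha : ∀ j, 0 < σ j * a j)
    (hP : ∀ v : ρ → ℝ, (∀ j, σ j < 0 → v j = 0) → 0 ≤ v ⬝ᵥ (C *ᵥ v))
    (hN : ∀ v : ρ → ℝ, (∀ j, 0 < σ j → v j = 0) → v ⬝ᵥ (C *ᵥ v) ≤ 0) :
    (Matrix.diagonal a + C).det ≠ 0 := by
  classical
  intro hdet
  obtain ⟨v, hv0, hMv⟩ := Matrix.exists_mulVec_eq_zero_iff.2 hdet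
  -- the two halves of `v` and the sign-flipped vector
  set vP : ρ → ℝ := fun j => if 0 < σ j then v j else 0 with hvP
  set vN : ρ → ℝ := fun j => if 0 < σ j then 0 else v j with hvN
  have hsum : v = vP + vN := by
    funext j
    simp only [hvP, hvN, Pi.add_apply]
    split_ifs <;> simp
  have hσ0 : ∀ j, σ j ≠ 0 := fun j h0 => by
    have := ha j
    rw [h0, zero_mul] at this
    exact lt_irrefl _ this
  -- sign bookkeeping: `s j * a j > 0`
  have hsa : ∀ j, 0 < (if 0 < σ j then (1 : ℝ) else -1) * a j := by
    intro j
    split_ifs with hj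
    · rw [one_mul]; exact pos_of_mul_pos_right (ha j) hj.le
    · have hσneg : σ j < 0 := lt_of_le_of_ne (not_lt.1 hj) (hσ0 j)
      have : a j < 0 := neg_of_mul_pos_right (ha j) hσneg.le
      linarith
  -- the flipped vector
  have hflip : (fun j => (if 0 < σ j then (1 : ℝ) else -1) * v j) = vP - vN := by
    funext j
    simp only [hvP, hvN, Pi.sub_apply]
    split_ifs <;> ring
  -- diagonal part of the pairing
  have hdiag : (vP - vN) ⬝ᵥ (Matrix.diagonal a *ᵥ v) = ∑ j, ((if 0 < σ j then (1 : ℝ) else -1) * a j) * v j ^ 2 := by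
    rw [← hflip, dotProduct]
    refine Finset.sum_congr rfl fun j _ => ?_
    rw [Matrix.mulVec_diagonal]
    ring
  have hdiag_nonneg : ∀ j ∈ (Finset.univ : Finset ρ), 0 ≤ ((if 0 < σ j then (1 : ℝ) else -1) * a j) * v j ^ 2 :=
    fun j _ => mul_nonneg (hsa j).le (sq_nonneg _)
  -- Gram part of the pairing
  have hPN : vP ⬝ᵥ (C *ᵥ vN) = vN ⬝ᵥ (C *ᵥ vP) := dotProduct_mulVec_comm_of_isSymm hC vP vN
  have hgram : (vP - vN) ⬝ᵥ (C *ᵥ v) = vP ⬝ᵥ (C *ᵥ vP) - vN ⬝ᵥ (C *ᵥ vN) := by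
    rw [hsum, Matrix.mulVec_add, sub_dotProduct, dotProduct_add, dotProduct_add, hPN]
    ring
  have hP' : 0 ≤ vP ⬝ᵥ (C *ᵥ vP) := hP vP fun j hj => by
    simp only [hvP]
    rw [if_neg (not_lt.2 hj.le)]
  have hN' : vN ⬝ᵥ (C *ᵥ vN) ≤ 0 := hN vN fun j hj => by
    simp only [hvN]
    rw [if_pos hj]
  -- the pairing vanishes since `(diag(a) + C) v = 0`
  have htot : (vP - vN) ⬝ᵥ ((Matrix.diagonal a + C) *ᵥ v) = 0 := by rw [hMv, dotProduct_zero]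
  rw [Matrix.add_mulVec, dotProduct_add, hdiag, hgram] at htot
  have hzero : ∑ j, ((if 0 < σ j then (1 : ℝ) else -1) * a j) * v j ^ 2 = 0 := by
    have h0 : 0 ≤ ∑ j, ((if 0 < σ j then (1 : ℝ) else -1) * a j) * v j ^ 2 := Finset.sum_nonneg hdiag_nonneg
    linarith
  -- hence `v = 0`
  apply hv0
  funext j
  have hj := (Finset.sum_eq_zero_iff_of_nonneg hdiag_nonneg).1 hzero j (Finset.mem_univ j)
  rcases mul_eq_zero.1 hj with h | h
  · exact absurd h (hsa j).ne'
  · simpa using h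

/-! ## §2  The sign-coherent Gram law -/

omit [Fintype ρ] [DecidableEq ρ] in
/-- The Gram matrix `UᵀB⁻¹U` of a symmetric base is symmetric. [folklore] -/
theorem isSymm_gram {B : Matrix ι ι ℝ} (hBs : B.IsSymm) (U : Matrix ι ρ ℝ) : (Uᵀ * B⁻¹ * U).IsSymm := by
  unfold Matrix.IsSymm
  rw [Matrix.transpose_mul, Matrix.transpose_mul, Matrix.transpose_transpose, Matrix.transpose_nonsing_inv, hBs.eq,
    Matrix.mul_assoc]

/-- **The dual matrix of a sign-coherent word is non-degenerate at every positive scale.** [folklore] -/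
theorem det_dual_ne_zero_of_coherent (B : Matrix ι ι ℝ) (hBs : B.IsSymm) (U : Matrix ι ρ ℝ) (σ : ρ → ℝ)
    (hσ : ∀ j, σ j ≠ 0) (E e : ℕ) (δ : ρ → ℕ)
    (hP : ∀ v : ρ → ℝ, (∀ j, σ j < 0 → v j = 0) → 0 ≤ v ⬝ᵥ ((Uᵀ * B⁻¹ * U) *ᵥ v))
    (hN : ∀ v : ρ → ℝ, (∀ j, 0 < σ j → v j = 0) → v ⬝ᵥ ((Uᵀ * B⁻¹ * U) *ᵥ v) ≤ 0)
    {x : ℝ} (hx : 0 < x) :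
    (Matrix.diagonal (fun j => (σ j)⁻¹ * x ^ (E - δ j)) + x ^ (E - e) • (Uᵀ * B⁻¹ * U)).det ≠ 0 := by
  have hCs : (x ^ (E - e) • (Uᵀ * B⁻¹ * U)).IsSymm := (isSymm_gram hBs U).smul _
  refine det_diagonal_add_ne_zero_of_coherent _ σ _ hCs (fun j => ?_) (fun v hv => ?_) (fun v hv => ?_)
  · rw [← mul_assoc, mul_inv_cancel₀ (hσ j), one_mul]
    exact pow_pos hx _
  · rw [Matrix.smul_mulVec, dotProduct_smul, smul_eq_mul]
    exact mul_nonneg (pow_pos hx _).le (hP v hv)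
  · rw [Matrix.smul_mulVec, dotProduct_smul, smul_eq_mul]
    exact mul_nonpos_of_nonneg_of_nonpos (pow_pos hx _).le (hN v hv)

/-- **THE SIGN-COHERENT GRAM LAW.**  `B` real symmetric, `det B ≠ 0`, signs `σⱼ ≠ 0`, arbitrary exponents; if the
Gram matrix `C = UᵀB⁻¹U` satisfies `vᵀCv ≥ 0` for all `v` supported on the positive columns and `vᵀCv ≤ 0` for all `v`
supported on the negative columns (no condition across), then `det(X^eB + U diag(σX^δ)Uᵀ)` has NO positive zero.
[folklore] -/
theorem posRoots_base_eq_empty_of_coherent (B : Matrix ι ι ℝ) (hBs : B.IsSymm) (hB : IsUnit B.det)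
    (U : Matrix ι ρ ℝ) (σ : ρ → ℝ) (hσ : ∀ j, σ j ≠ 0) (e : ℕ) (δ : ρ → ℕ)
    (hP : ∀ v : ρ → ℝ, (∀ j, σ j < 0 → v j = 0) → 0 ≤ v ⬝ᵥ ((Uᵀ * B⁻¹ * U) *ᵥ v))
    (hN : ∀ v : ρ → ℝ, (∀ j, 0 < σ j → v j = 0) → v ⬝ᵥ ((Uᵀ * B⁻¹ * U) *ᵥ v) ≤ 0) :
    (Matrix.det (𝔽ₛ[e, B, U, σ, δ])).roots.toFinset.filter (fun t => 0 < t) = ∅ := by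
  classical
  obtain ⟨E, he, hδ⟩ := exists_bound e δ
  rw [posRoots_base_eq B hB U σ hσ e E δ he hδ, Finset.filter_eq_empty_iff]
  intro t ht hpos
  rw [Multiset.mem_toFinset, Polynomial.mem_roots', Polynomial.IsRoot.def, eval_det_baseDual] at ht
  exact det_dual_ne_zero_of_coherent B hBs U σ hσ E e δ hP hN hpos ht.2

/-- Counted form: `Z₊ = 0` on the sign-coherent sector. [folklore] -/
theorem card_posRoots_base_eq_zero_of_coherent (B : Matrix ι ι ℝ) (hBs : B.IsSymm) (hB : IsUnit B.det)
    (U : Matrix ι ρ ℝ) (σ : ρ → ℝ) (hσ : ∀ j, σ j ≠ 0) (e : ℕ) (δ : ρ → ℕ)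
    (hP : ∀ v : ρ → ℝ, (∀ j, σ j < 0 → v j = 0) → 0 ≤ v ⬝ᵥ ((Uᵀ * B⁻¹ * U) *ᵥ v))
    (hN : ∀ v : ρ → ℝ, (∀ j, 0 < σ j → v j = 0) → v ⬝ᵥ ((Uᵀ * B⁻¹ * U) *ᵥ v) ≤ 0) :
    ((Matrix.det (𝔽ₛ[e, B, U, σ, δ])).roots.toFinset.filter (fun t => 0 < t)).card = 0 := by
  rw [posRoots_base_eq_empty_of_coherent B hBs hB U σ hσ e δ hP hN, Finset.card_empty]

/-! ## §3  Semidefinite Gram matrices: PSD (resp. NSD) letters in a `B⁻¹`-nonnegative (resp. nonpositive)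
configuration are sterile -/

/-- **POSITIVE columns, PSD Gram ⇒ no positive zero**: `σⱼ > 0` for all `j` and `UᵀB⁻¹U ⪰ 0` (the columns span a
`B⁻¹`-nonnegative configuration) ⇒ `det(X^eB + U diag(σX^δ)Uᵀ)` has no positive zero, for every symmetric
non-degenerate `B` (indefinite allowed) and all exponents. [folklore] -/
theorem posRoots_base_eq_empty_of_posSemidef_gram (B : Matrix ι ι ℝ) (hBs : B.IsSymm) (hB : IsUnit B.det)
    (U : Matrix ι ρ ℝ) (σ : ρ → ℝ) (hσ : ∀ j, 0 < σ j) (e : ℕ) (δ : ρ → ℕ)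
    (hC : (Uᵀ * B⁻¹ * U).PosSemidef) :
    (Matrix.det (𝔽ₛ[e, B, U, σ, δ])).roots.toFinset.filter (fun t => 0 < t) = ∅ := by
  refine posRoots_base_eq_empty_of_coherent B hBs hB U σ (fun j => (hσ j).ne') e δ (fun v _ => ?_)
    (fun v hv => ?_)
  · simpa only [star_trivial] using hC.dotProduct_mulVec_nonneg v
  · have hv0 : v = 0 := funext fun j => hv j (hσ j)
    rw [hv0, Matrix.mulVec_zero, dotProduct_zero]

/-- **NEGATIVE columns, NSD Gram ⇒ no positive zero** (the mirror): `σⱼ < 0` for all `j` and `−UᵀB⁻¹U ⪰ 0`.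
[folklore] -/
theorem posRoots_base_eq_empty_of_negSemidef_gram (B : Matrix ι ι ℝ) (hBs : B.IsSymm) (hB : IsUnit B.det)
    (U : Matrix ι ρ ℝ) (σ : ρ → ℝ) (hσ : ∀ j, σ j < 0) (e : ℕ) (δ : ρ → ℕ)
    (hC : (-(Uᵀ * B⁻¹ * U)).PosSemidef) :
    (Matrix.det (𝔽ₛ[e, B, U, σ, δ])).roots.toFinset.filter (fun t => 0 < t) = ∅ := by
  refine posRoots_base_eq_empty_of_coherent B hBs hB U σ (fun j => (hσ j).ne) e δ (fun v hv => ?_)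
    (fun v _ => ?_)
  · have hv0 : v = 0 := funext fun j => hv j (hσ j)
    rw [hv0, Matrix.mulVec_zero, dotProduct_zero]
  · have h := hC.dotProduct_mulVec_nonneg v
    simp only [star_trivial, Matrix.neg_mulVec, dotProduct_neg] at h
    linarith

/-! ## §4  The law in the crux's currency: PSD and NSD letters around a non-degenerate letter -/

section Pencil

variable {K m : ℕ}

/-- Over `ℝ` a symmetric matrix is hermitian. [folklore] -/
theorem isHermitian_of_isSymm_real {A : Matrix (Fin m) (Fin m) ℝ} (hA : A.IsSymm) : A.IsHermitian := by
  unfold Matrix.IsHermitian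
  rw [Matrix.conjTranspose_eq_transpose_of_trivial]
  exact hA

/-- An eigenvalue is the value of the quadratic form at its unit eigenvector (real case). [folklore] -/
theorem eigenvalues_eq_form {A : Matrix (Fin m) (Fin m) ℝ} (hA : A.IsHermitian) (i : Fin m) :
    hA.eigenvalues i = ⇑(hA.eigenvectorBasis i) ⬝ᵥ (A *ᵥ ⇑(hA.eigenvectorBasis i)) := by
  have h := hA.eigenvalues_eq i
  simpa only [RCLike.re_to_real, star_trivial] using h

/-- The eigenvalues of a matrix whose negative is PSD are `≤ 0`. [folklore] -/
theorem eigenvalues_nonpos_of_neg_posSemidef {A : Matrix (Fin m) (Fin m) ℝ} (hA : A.IsHermitian)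
    (hN : (-A).PosSemidef) (i : Fin m) : hA.eigenvalues i ≤ 0 := by
  rw [eigenvalues_eq_form hA i]
  have h := hN.dotProduct_mulVec_nonneg (⇑(hA.eigenvectorBasis i))
  simp only [star_trivial, Matrix.neg_mulVec, dotProduct_neg] at h
  linarith

/-- The eigenvalues of a PSD matrix are `≥ 0` (Mathlib, restated for the hermitian proof at hand). [folklore] -/
theorem eigenvalues_nonneg_of_posSemidef' {A : Matrix (Fin m) (Fin m) ℝ} (hA : A.IsHermitian)
    (hP : A.PosSemidef) (i : Fin m) : 0 ≤ hA.eigenvalues i := by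
  rw [eigenvalues_eq_form hA i]
  simpa only [star_trivial] using hP.dotProduct_mulVec_nonneg (⇑(hA.eigenvectorBasis i))

/-- **Range vector.**  Every combination `U v` of the non-zero eigen-columns of the letters `l ≠ l₀` is a sum
`Σ_l S_l w_l` with `w_{l₀} = 0` and `w_l = 0` unless some coefficient `v_{(l,i)}` is non-zero
(`w_l = Σ_i (v_{(l,i)}/λ_{l,i}) p_{l,i}`). [folklore] -/
theorem exists_rangeVector (S : Fin K → Matrix (Fin m) (Fin m) ℝ) (hH : ∀ l, (S l).IsHermitian) (l₀ : Fin K)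
    (v : {li : Fin K × Fin m // li.1 ≠ l₀ ∧ (hH li.1).eigenvalues li.2 ≠ 0} → ℝ) :
    ∃ w : Fin K → Fin m → ℝ, w l₀ = 0 ∧
      (∀ l, w l ≠ 0 → ∃ i, ∃ h : l ≠ l₀ ∧ (hH l).eigenvalues i ≠ 0, v ⟨(l, i), h⟩ ≠ 0) ∧
      (Matrix.of fun (a : Fin m) (t : {li : Fin K × Fin m // li.1 ≠ l₀ ∧ (hH li.1).eigenvalues li.2 ≠ 0}) =>
          ((hH t.1.1).eigenvectorUnitary : Matrix (Fin m) (Fin m) ℝ) a t.1.2) *ᵥ v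
        = ∑ l, S l *ᵥ w l := by
  classical
  -- coefficient of the eigen-column `(l, i)`
  set c : Fin K → Fin m → ℝ := fun l i =>
    if h : l ≠ l₀ ∧ (hH l).eigenvalues i ≠ 0 then v ⟨(l, i), h⟩ else 0 with hc
  have hc0 : ∀ l i, ¬ (l ≠ l₀ ∧ (hH l).eigenvalues i ≠ 0) → c l i = 0 := fun l i h => by
    simp only [hc]
    rw [dif_neg h]
  refine ⟨fun l => ∑ i, (c l i / (hH l).eigenvalues i) • ⇑((hH l).eigenvectorBasis i), ?_, ?_, ?_⟩
  · refine Finset.sum_eq_zero fun i _ => ?_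
    rw [hc0 l₀ i fun h => h.1 rfl, zero_div, zero_smul]
  · intro l hl
    by_contra hnone
    push Not at hnone
    apply hl
    refine Finset.sum_eq_zero fun i _ => ?_
    have : c l i = 0 := by
      by_cases h : l ≠ l₀ ∧ (hH l).eigenvalues i ≠ 0
      · simp only [hc]
        rw [dif_pos h]
        exact hnone i h
      · exact hc0 l i h
    rw [this, zero_div, zero_smul]
  · -- `S_l w_l = Σ_i c_{l i} p_{l i}`
    have hSl : ∀ l, S l *ᵥ (∑ i, (c l i / (hH l).eigenvalues i) • ⇑((hH l).eigenvectorBasis i))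
        = ∑ i, c l i • ⇑((hH l).eigenvectorBasis i) := by
      intro l
      rw [Matrix.mulVec_sum]
      refine Finset.sum_congr rfl fun i _ => ?_
      rw [Matrix.mulVec_smul, (hH l).mulVec_eigenvectorBasis i, smul_smul]
      by_cases h : l ≠ l₀ ∧ (hH l).eigenvalues i ≠ 0
      · rw [div_mul_cancel₀ _ h.2]
      · rw [hc0 l i h, zero_div, zero_mul]
    simp only [hSl]
    funext a
    rw [Finset.sum_apply]
    simp only [Finset.sum_apply, Pi.smul_apply, smul_eq_mul, Matrix.mulVec, dotProduct, Matrix.of_apply,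
      Matrix.IsHermitian.eigenvectorUnitary_apply]
    -- right side as a sum over pairs, then over the subtype
    rw [← Fintype.sum_prod_type' (fun l i => c l i * ⇑((hH l).eigenvectorBasis i) a)]
    rw [← Finset.sum_filter_of_ne (s := (Finset.univ : Finset (Fin K × Fin m)))
        (p := fun li : Fin K × Fin m => li.1 ≠ l₀ ∧ (hH li.1).eigenvalues li.2 ≠ 0)
        (fun li _ hne => by
          by_contra h
          exact hne (by rw [hc0 li.1 li.2 h, zero_mul]))]
    rw [Finset.sum_subtype (Finset.univ.filter fun li : Fin K × Fin m => li.1 ≠ l₀ ∧ (hH li.1).eigenvalues li.2 ≠ 0)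
        (p := fun li : Fin K × Fin m => li.1 ≠ l₀ ∧ (hH li.1).eigenvalues li.2 ≠ 0)
        (fun li => by simp only [Finset.mem_filter, Finset.mem_univ, true_and])]
    refine Finset.sum_congr rfl fun t _ => ?_
    have hct : c t.1.1 t.1.2 = v t := by
      simp only [hc]
      rw [dif_pos t.2]
    rw [hct, mul_comm]

/-- **THE SIGN-COHERENT LAW IN THE CRUX'S CURRENCY.**  Real symmetric letters `S_l`, a non-degenerate letter `S_{l₀}`,
every other letter PSD or NSD, exponents arbitrary.  If `S_{l₀}⁻¹` is positive semidefinite on the joint range of the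
PSD letters (`(Σ_l S_l w_l)ᵀ S_{l₀}⁻¹ (Σ_l S_l w_l) ≥ 0` whenever `w` is supported on PSD letters `≠ l₀`) and negative
semidefinite on the joint range of the NSD letters, then `det(Σ_l X^{d_l} S_l)` has NO positive zero. [folklore] -/
theorem coherent_pencil_posRoots_eq_empty (d : Fin K → ℕ) (S : Fin K → Matrix (Fin m) (Fin m) ℝ)
    (hS : ∀ l, (S l).IsSymm) (l₀ : Fin K) (hS₀ : IsUnit (S l₀).det)
    (hsgn : ∀ l, l ≠ l₀ → (S l).PosSemidef ∨ (-(S l)).PosSemidef)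
    (hP : ∀ w : Fin K → Fin m → ℝ, w l₀ = 0 → (∀ l, w l ≠ 0 → (S l).PosSemidef) →
        0 ≤ (∑ l, S l *ᵥ w l) ⬝ᵥ ((S l₀)⁻¹ *ᵥ ∑ l, S l *ᵥ w l))
    (hN : ∀ w : Fin K → Fin m → ℝ, w l₀ = 0 → (∀ l, w l ≠ 0 → (-(S l)).PosSemidef) →
        (∑ l, S l *ᵥ w l) ⬝ᵥ ((S l₀)⁻¹ *ᵥ ∑ l, S l *ᵥ w l) ≤ 0) :
    (Matrix.det (∑ l, ((Polynomial.X : Polynomial ℝ) ^ d l) • (S l).map Polynomial.C)).roots.toFinset.filter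
        (fun t => 0 < t) = ∅ := by
  classical
  have hH : ∀ l, (S l).IsHermitian := fun l => isHermitian_of_isSymm_real (hS l)
  rw [pencil_eq_base_add_signedPart d S hH l₀]
  have h := posRoots_base_eq_empty_of_coherent (S l₀) (hS l₀) hS₀
    (Matrix.of fun (a : Fin m) (t : {li : Fin K × Fin m // li.1 ≠ l₀ ∧ (hH li.1).eigenvalues li.2 ≠ 0}) =>
      ((hH t.1.1).eigenvectorUnitary : Matrix (Fin m) (Fin m) ℝ) a t.1.2)
    (fun t : {li : Fin K × Fin m // li.1 ≠ l₀ ∧ (hH li.1).eigenvalues li.2 ≠ 0} => (hH t.1.1).eigenvalues t.1.2)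
    (fun t => t.2.2) (d l₀)
    (fun t : {li : Fin K × Fin m // li.1 ≠ l₀ ∧ (hH li.1).eigenvalues li.2 ≠ 0} => d t.1.1) ?_ ?_
  · dsimp only at h ⊢
    rw [h]
  · -- positive columns: `U v` lies in the joint range of the PSD letters
    intro v hv
    obtain ⟨w, hw0, hwsupp, hUv⟩ := exists_rangeVector S hH l₀ v
    rw [← form_conj, hUv]
    refine hP w hw0 fun l hl => ?_
    obtain ⟨i, h, hvi⟩ := hwsupp l hl
    rcases hsgn l h.1 with hpsd | hnsd
    · exact hpsd
    · exact absurd (hv ⟨(l, i), h⟩ (lt_of_le_of_ne (eigenvalues_nonpos_of_neg_posSemidef (hH l) hnsd i) h.2)) hvi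
  · -- negative columns: `U v` lies in the joint range of the NSD letters
    intro v hv
    obtain ⟨w, hw0, hwsupp, hUv⟩ := exists_rangeVector S hH l₀ v
    rw [← form_conj, hUv]
    refine hN w hw0 fun l hl => ?_
    obtain ⟨i, h, hvi⟩ := hwsupp l hl
    rcases hsgn l h.1 with hpsd | hnsd
    · exact absurd (hv ⟨(l, i), h⟩
        (lt_of_le_of_ne (eigenvalues_nonneg_of_posSemidef' (hH l) hpsd i) (Ne.symm h.2))) hvi
    · exact hnsd

/-- **PSD letters in an `S_{l₀}⁻¹`-nonnegative configuration are sterile** (crux currency): all letters `≠ l₀` PSD and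
`S_{l₀}⁻¹ ⪰ 0` on their joint range ⇒ no positive zero of `det(Σ_l X^{d_l} S_l)`, at every size and all exponents.
(Trivial when `S_{l₀} ≻ 0`; the content is for INDEFINITE `S_{l₀}`.) [folklore] -/
theorem psdLetters_pencil_posRoots_eq_empty (d : Fin K → ℕ) (S : Fin K → Matrix (Fin m) (Fin m) ℝ)
    (hS : ∀ l, (S l).IsSymm) (l₀ : Fin K) (hS₀ : IsUnit (S l₀).det) (hpsd : ∀ l, l ≠ l₀ → (S l).PosSemidef)
    (hP : ∀ w : Fin K → Fin m → ℝ, w l₀ = 0 →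
        0 ≤ (∑ l, S l *ᵥ w l) ⬝ᵥ ((S l₀)⁻¹ *ᵥ ∑ l, S l *ᵥ w l)) :
    (Matrix.det (∑ l, ((Polynomial.X : Polynomial ℝ) ^ d l) • (S l).map Polynomial.C)).roots.toFinset.filter
        (fun t => 0 < t) = ∅ := by
  refine coherent_pencil_posRoots_eq_empty d S hS l₀ hS₀ (fun l hl => Or.inl (hpsd l hl))
    (fun w hw0 _ => hP w hw0) (fun w hw0 hw => ?_)
  -- a vector supported on NSD letters is supported on letters that are PSD and NSD, i.e. zero letters
  have hzero : ∀ l, S l *ᵥ w l = 0 := by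
    intro l
    by_cases hl : w l = 0
    · rw [hl, Matrix.mulVec_zero]
    · have hl₀ : l ≠ l₀ := fun h => hl (h ▸ hw0)
      have h1 : (S l).PosSemidef := hpsd l hl₀
      have h2 : (-(S l)).PosSemidef := hw l hl
      have e1 := h1.dotProduct_mulVec_nonneg (w l)
      have e2 := h2.dotProduct_mulVec_nonneg (w l)
      rw [Matrix.neg_mulVec, dotProduct_neg] at e2
      exact (h1.dotProduct_mulVec_zero_iff (w l)).1 (le_antisymm (by linarith) e1)
  simp only [hzero, Finset.sum_const_zero, Matrix.mulVec_zero, dotProduct_zero, le_refl]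

end Pencil

end GramDual

end Summit.ValiantsHypothesis.ValiantsHypothesis.Theorems.LacunarySymmetroidMatrixDescartes
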